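import Summits.QuantumFields.YangMills.Theses.MarginalTwistOnset
import HarnessLib

/-!
# Route `MarginalTwistOnset`: the support item `FractionalMomentTransfer` (stmt-QuantumFields-9805)

Hölder transfer of a fractional moment to a tilted first moment (the fractional-moment form of the
change-of-measure step of the disorder-relevance method, Derrida–Giacomin–Lacoin–Toninelli 2009 / Lacoin 2009 /
Berger–Lacoin 2017): for probability measures `μ ≪ ν`, measurable `f ≥ 0` and `θ ∈ (0,1)`,

`∫⁻ f^θ dμ ≤ (∫⁻ f dν)^θ · (∫⁻ (dμ/dν)^{1/(1−θ)} dν)^{1−θ}`.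

Proof: `∫⁻ f^θ dμ = ∫⁻ f^θ · (dμ/dν) dν` (`MeasureTheory.lintegral_rnDeriv_mul`) and Hölder
(`ENNReal.lintegral_mul_le_Lp_mul_Lq`) with the conjugate exponents `p = 1/θ`, `q = 1/(1−θ)`.
Pure measure theory over Mathlib; nothing here is specific to Yang–Mills and no summit, leg or crux statement
is proved (width seat ym-t4-w17 g0, free hands).
-/

set_option autoImplicit false

namespace Summit.QuantumFields.YangMills.Theorems

open MeasureTheory
open scoped ENNReal

/-- **Hölder transfer of a fractional moment** (general measurable-space form): for `μ ≪ ν` with a Lebesgue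
decomposition, measurable `f : Ω → ℝ≥0∞` and `0 < θ < 1`,
`∫⁻ f^θ dμ ≤ (∫⁻ f dν)^θ · (∫⁻ (dμ/dν)^{1/(1−θ)} dν)^{1−θ}`. [folklore] -/
theorem lintegral_rpow_le_of_absolutelyContinuous {Ω : Type*} [MeasurableSpace Ω]
    (μ ν : Measure Ω) [μ.HaveLebesgueDecomposition ν] (hμν : μ ≪ ν)
    (f : Ω → ℝ≥0∞) (hf : Measurable f) (θ : ℝ) (hθ0 : 0 < θ) (hθ1 : θ < 1) :
    ∫⁻ x, f x ^ θ ∂μ ≤ (∫⁻ x, f x ∂ν) ^ θ * (∫⁻ x, μ.rnDeriv ν x ^ (1 / (1 - θ)) ∂ν) ^ (1 - θ) := by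
  have h1θ : 0 < 1 - θ := sub_pos.mpr hθ1
  -- conjugate exponents `p = 1/θ`, `q = 1/(1-θ)`
  have hpq : (1 / θ).HolderConjugate (1 / (1 - θ)) :=
    Real.holderConjugate_one_div hθ0 h1θ (by ring)
  -- change of measure
  have hchange : ∫⁻ x, f x ^ θ ∂μ = ∫⁻ x, ((fun x => f x ^ θ) * μ.rnDeriv ν) x ∂ν := by
    rw [← MeasureTheory.lintegral_rnDeriv_mul hμν (hf.pow_const θ).aemeasurable]
    simp only [Pi.mul_apply, mul_comm]
  rw [hchange]
  refine (ENNReal.lintegral_mul_le_Lp_mul_Lq ν hpq (hf.pow_const θ).aemeasurable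
    (Measure.measurable_rnDeriv μ ν).aemeasurable).trans (le_of_eq ?_)
  -- `(f^θ)^(1/θ) = f`, `1/(1/θ) = θ`, `1/(1/(1-θ)) = 1-θ`
  have hexp : ∀ x, (f x ^ θ) ^ (1 / θ) = f x := fun x => by
    rw [← ENNReal.rpow_mul, mul_one_div_cancel hθ0.ne', ENNReal.rpow_one]
  simp only [hexp, one_div_one_div]

/-- **Item stmt-QuantumFields-9805 `MarginalTwistOnset.FractionalMomentTransfer` holds.** [folklore] -/
theorem marginalTwistOnset_fractionalMomentTransfer_proof :
    Summit.QuantumFields.YangMills.Theses.MarginalTwistOnset.FractionalMomentTransfer := by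
  unfold Summit.QuantumFields.YangMills.Theses.MarginalTwistOnset.FractionalMomentTransfer
  intro Ω _ μ ν _ _ hμν f hf θ hθ0 hθ1
  exact lintegral_rpow_le_of_absolutelyContinuous μ ν hμν f hf θ hθ0 hθ1

end Summit.QuantumFields.YangMills.Theorems
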